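import Mathlib
import Summits.PneNP.PneNP.Theorems.ChebyshevTracialDesignParityKernel
import Literature.Combinatorics.Optimization.TracialDesigns
import Literature.Combinatorics.Optimization.ChebyshevExtrapolationDesign
import Summits.PneNP.PneNP.Theorems.ChebyshevTracialDesignSaturatedSubsets

/-!
# Cell pnp-psdrank, route `ChebyshevTracialDesign`: the crux `TracialDecayExp20` implies a STRETCHED-EXPONENTIAL psd-rank lower bound
# for every parity kernel `F_σ(U,M) = (Σ_{e ∈ M ∩ δ(U)} σ_e)² − 1` (stmt-PneNP-19878; eng g12, MEMO-12 §4(b))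

The route's assembly (`Assembly2_proof`) turns the crux into the psd-rank lower bound for the slack matrix `cc − 1` through three facts about
the slack: it is `≤ n²`, it vanishes on the tight pairs, and every balanced exact design pairs with it to `1`
[cite: Rothvoss2017, §2 (PDF p. 6, eq. (2))]. The parity kernels `F_σ` of `ChebyshevTracialDesignParityKernel` have the same three
properties for EVERY sign pattern `σ` (`design_value_parityKernel`), so the same two lines (`Literature.Combinatorics.Optimization.
tracialHyperplaneBoundAt_holds`, the Auerbach/Briët–Dadush–Pokutta rescaling [cite: BrietDadushPokutta2014, Thm. 6 (§3)], and the crux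
in the dimension budget `r²n < e^{a·dq n}`) give:
* `parity_psdRank_of_tracialDecayExp20` — if `TracialDecayExp20` holds (the hypothesis is the route decl's BODY verbatim, in Literature
  vocabulary, so that this file does not import the route file; apply it to `hE : TracialDecayExp20` directly) then there are `a > 0`, `p`,
  `n₁` such that for all even `n ≥ n₁`,
  every `σ : Sym2 (Fin n) → {±1}` and every `r` with `r²·n < e^{a·dq n}` and `r^p·n² < e^{a·dq n}`, the kernel `F_σ` on
  (odd sets × perfect matchings of `K_n`) has NO psd factorization of size `r` (`HasPsdFactorization`, [cite: FawziEtAl2015, Thm. 2.9 (v) (p06–p07)]).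
So the crux is at least as strong as a psd-rank lower bound `e^{Ω(n^{1/4})}` for an explicit family of `2^{C(n,2)}` nonnegative matrices, of
which the slack matrix is the average — a refuter target with no design or tightness bookkeeping (MEMO-12 §4(b)).
Stature: support/instrument (conditional on the open crux; pure bookkeeping). WHAT THIS IS NOT: no unconditional psd-rank bound for any
`F_σ`; nothing on `P_PM(K_n)`; no P-vs-NP content.
-/

set_option linter.dupNamespace false -- `Summit.PneNP.PneNP.…`: summit = sub-problem (D-0017)

noncomputable section

namespace Summit.PneNP.PneNP.Theorems.ChebyshevTracialDesignParityPsdRank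

open Finset Literature.Barriers.PneNP Literature.Combinatorics.SimpleGraph.CycleSpace Literature.Combinatorics.Optimization
open Summit.PneNP.PneNP.Theorems.ChebyshevTracialDesignParityKernel

variable {n : ℕ}

/-- The signed crossing sum is at most the crossing number in absolute value, hence `F_σ ≤ n²`. -/
theorem parityKernel_le_sq (σ : Sym2 (Fin n) → ℝ) (hσ : ∀ e, σ e = 1 ∨ σ e = -1) (U : OddSet n) (M : PMatch n) :
    (∑ e ∈ M.1.filter (Crosses U.1), σ e) ^ 2 - 1 ≤ (n : ℝ) ^ 2 := by
  have habs : |∑ e ∈ M.1.filter (Crosses U.1), σ e| ≤ (cc U M : ℝ) := by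
    refine (abs_sum_le_sum_abs _ _).trans ?_
    have h1 : ∀ e, |σ e| = 1 := by intro e; rcases hσ e with h | h <;> rw [h] <;> norm_num
    simp only [h1, sum_const, nsmul_eq_mul, mul_one]
    exact le_of_eq rfl
  have hcc : (cc U M : ℝ) ≤ n := by
    have h2 := ChebyshevTracialDesignSaturatedSubsets.card_eq_cc_add U M
    have h3 : U.1.card ≤ n := by
      have := card_le_univ U.1; rwa [Fintype.card_fin] at this
    exact_mod_cast (by omega : cc U M ≤ n)
  have hsq : (∑ e ∈ M.1.filter (Crosses U.1), σ e) ^ 2 ≤ (n : ℝ) ^ 2 := by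
    rw [← sq_abs]
    exact pow_le_pow_left₀ (abs_nonneg _) (habs.trans hcc) 2
  linarith

/-- `dq n ≥ 2` once `n ≥ 16`. -/
theorem two_le_dq {n : ℕ} (hn : 16 ≤ n) : 2 ≤ dq n := by
  unfold dq
  have h1 : 4 ≤ Nat.sqrt n := by
    rw [Nat.le_sqrt]; omega
  rw [Nat.le_sqrt]; omega

/-- **The crux implies a stretched-exponential psd-rank lower bound for every parity kernel.** -/
theorem parity_psdRank_of_tracialDecayExp20
    (hE : ∃ a : ℝ, 0 < a ∧ ∃ n₁ : ℕ, ∀ n : ℕ, n₁ ≤ n → Even n → ∀ (t : ℕ) (C : Finset ℕ) (w : ℕ → ℝ),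
      IsBalancedDesign n t (Tq n) (dq n) 20 C w → ∀ r : ℕ, 0 < r → (r : ℝ) ^ 2 * n < Real.exp (a * (dq n : ℝ)) →
        TracialValueLEAt (levelWeight n t C w) (Real.exp (-(a * (dq n : ℝ)))) r) :
    ∃ a : ℝ, 0 < a ∧ ∃ p : ℕ, ∃ n₁ : ℕ, ∀ n : ℕ, n₁ ≤ n → Even n →
      ∀ σ : Sym2 (Fin n) → ℝ, (∀ e, σ e = 1 ∨ σ e = -1) →
      ∀ r : ℕ, (r : ℝ) ^ 2 * n < Real.exp (a * (dq n : ℝ)) → (r : ℝ) ^ p * (n : ℝ) ^ 2 < Real.exp (a * (dq n : ℝ)) →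
        ¬ HasPsdFactorization (fun (U : OddSet n) (M : PMatch n) => (∑ e ∈ M.1.filter (Crosses U.1), σ e) ^ 2 - 1) r := by
  obtain ⟨p, hp⟩ := tracialHyperplaneBoundAt_holds
  obtain ⟨a, ha, n₁, hdec⟩ := hE
  obtain ⟨n₃, hdes⟩ := chebyshevDesignExistsBal_twenty
  refine ⟨a, ha, p, max n₁ (max n₃ 16), fun n hn hev σ hσ r h1 h2 hfac => ?_⟩
  have hn₁ : n₁ ≤ n := le_trans (le_max_left _ _) hn
  have hn₃ : n₃ ≤ n := le_trans (le_max_left _ _) (le_trans (le_max_right _ _) hn)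
  have hn16 : 16 ≤ n := le_trans (le_max_right _ _) (le_trans (le_max_right _ _) hn)
  obtain ⟨t, C, w, hbal⟩ := hdes n hn₃ hev
  -- the design pairs with `F_σ` to exactly `1`
  have hval := design_value_parityKernel hbal.1 (two_le_dq hn16) σ hσ
  rcases Nat.eq_zero_or_pos r with rfl | hr0
  · -- `r = 0`: `F_σ` would vanish identically
    obtain ⟨A, B, -, -, hS⟩ := hfac
    have h0 : ∀ (U : OddSet n) (M : PMatch n), (∑ e ∈ M.1.filter (Crosses U.1), σ e) ^ 2 - 1 = 0 := fun U M => by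
      have hS' := hS U M
      dsimp only at hS'
      rw [hS']; simp [Matrix.trace]
    simp only [h0, mul_zero, sum_const_zero] at hval
    exact zero_ne_one hval
  · have hW := hdec n hn₁ hev t C w hbal r hr0 h1
    have hbound := hp n r (fun U M => (∑ e ∈ M.1.filter (Crosses U.1), σ e) ^ 2 - 1) (levelWeight n t C w)
      ((n : ℝ) ^ 2) (Real.exp (-(a * (dq n : ℝ)))) (by positivity) (fun U M => parityKernel_le_sq σ hσ U M)
      (fun U M hUM => (parityKernel_nonneg_and_tight σ hσ U M).2 hUM) hW hfac
    rw [hval] at hbound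
    have h3 : (r : ℝ) ^ p * (n : ℝ) ^ 2 * Real.exp (-(a * (dq n : ℝ))) < 1 := by
      rw [Real.exp_neg, ← div_eq_mul_inv, div_lt_one (Real.exp_pos _)]
      exact h2
    linarith

end Summit.PneNP.PneNP.Theorems.ChebyshevTracialDesignParityPsdRank

end
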